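import Summits.BirchSwinnertonDyer.BirchSwinnertonDyer.Theorems.KatoDescentPotSupersingularMemberHullZetaInputsOfCorePrelim
import Summits.BirchSwinnertonDyer.BirchSwinnertonDyer.Theorems.KatoDescentPotSupersingularMemberHullNondegenerate
import Summits.BirchSwinnertonDyer.BirchSwinnertonDyer.Theorems.KatoDescentPotSupersingularMemberHullRankOne
import Literature.NumberTheory.EllipticCurves.Kato2004.MemberHullZetaCoreInputs
import HarnessLib

/-!
# Three more clauses of the CORE package are theorems of its other fields: `z_ne_zero` (Thm. 12.5 (1)), `lam_constantCoeff_ne_zero`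
# (Lemma 13.10 (1), `λ(0) ≠ 0`) and `isTorsion_quotient` (Thm. 12.5 (2)) follow from the hull fields and clause (b′) `zetaLineIndex`
# (route `KatoDescentPotSupersingular` / `…Tame…`, crux M = stmt-BirchSwinnertonDyer-19196; route-free helper)

Seat `bsd-potss-rkm` g21 (prover; cell `bsd-potss`), item stmt-BirchSwinnertonDyer-19196 (`--supports … --as helper`; closes nothing).
HONEST FRAMING: BSD is not proved by any of this; nothing is booked; theorems only (no definition, no named fact).

## What (a note for the NEXT re-type, not a change to the landed one)

In the core package `Kato2004.MemberHullZetaCoreInputs` (p630270) the clause (b′) `zetaLineIndex` forces the bottom class `proj₀ 𝐲` of the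
zeta family to have infinite order (`not_isOfFinAddOrder_of_zetaLineOrthIndexAt`, part 61a, given ONE Poitou–Tate family to instantiate it).
rkm g10 showed (`MemberHullNondegenerate`, `MemberHullRankOne`) that the non-torsion of `proj₀ 𝐲` together with the hull fields
(`j` injective with finite cokernel, `j 𝐲 = λ • z`, `F` finitely generated torsion-free) and (R0) gives `λ(0) ≠ 0`, `z ≠ 0`, and
`F ⧸ Λz` torsion.  Hence, on a core package, the three fields `lam_constantCoeff_ne_zero`, `z_ne_zero`, `isTorsion_quotient` are
REDUNDANT (the proofs below use none of them): a leaner re-type could drop them, leaving {hull data `F, j, z, λ, j 𝐲 = λ•z`; Kato's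
`𝐇²` with (14.14.1), `divisibility_offP`, `mu_H2`, (c2′) `katoH2Count`; (b′) `zetaLineIndex`} as the whole held content.

* `MemberHullZetaCoreInputs.not_isOfFinAddOrder_projZero` — `proj₀ 𝐲` is not torsion (from (b′));
* `….lam_constantCoeff_ne_zero_of_zetaLineIndex`, `….z_ne_zero_of_zetaLineIndex`, `….isTorsion_quotient_of_zetaLineIndex`.

References: K. Kato, Astérisque 295 (2004), Thm. 12.5 (1)(2) (pp. 221–222), Lemma 13.10 (1) (p. 230), 13.14 (p. 234), Thm. 14.5 (2) (p. 236)
[Kato2004Asterisque].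
-/

-- the summit and its single problem are both named `BirchSwinnertonDyer` (registry layout D-0017)
set_option linter.dupNamespace false
set_option autoImplicit false

noncomputable section

open scoped Classical NumberField TensorProduct
open CategoryTheory Function Field NumberField IsDedekindDomain
open Literature.NumberTheory.EllipticCurves Literature.NumberTheory.GaloisRepresentations Literature.NumberTheory.GaloisCohomology
open Literature.NumberTheory.EllipticCurves.Kato2004 Literature.NumberTheory.EllipticCurves.Kato2004.EulerSystemValues
open Literature.NumberTheory.EllipticCurves.IwasawaAlgebra
open Summit.BirchSwinnertonDyer.BirchSwinnertonDyer.Theorems.MemberHullZetaInputsOfCore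
open Summit.BirchSwinnertonDyer.BirchSwinnertonDyer.Theorems.MemberHullNondegenerate
open Summit.BirchSwinnertonDyer.BirchSwinnertonDyer.Theorems.MemberHullRankOne

namespace Summit.BirchSwinnertonDyer.BirchSwinnertonDyer.Theorems.CoreRedundantClauses

variable {W : WeierstrassCurve ℚ} [W.IsElliptic] {p : ℕ} [Fact p.Prime]
  [ContinuousSMul ℤ_[p] (W.tateModule p)] {κ : ZpExtension ℚ p} {γ : absoluteGaloisGroup ℚ}
  {I : IwasawaH1Data W p κ γ} {y : I.H}

/-- **On a core package, `proj₀ 𝐲` is NOT torsion** (clause (b′) `zetaLineIndex` and `not_isOfFinAddOrder_of_zetaLineOrthIndexAt`; one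
Poitou–Tate family from `poitouTate_selmerStructure_duality ℚ` to instantiate the predicate). [cite: Kato2004Asterisque, Thm. 14.5 (2) (p. 236)] -/
theorem _root_.Literature.NumberTheory.EllipticCurves.Kato2004.MemberHullZetaCoreInputs.not_isOfFinAddOrder_projZero
    (Z : MemberHullZetaCoreInputs W p κ γ I y) (hPT : poitouTate_selmerStructure_duality ℚ) :
    ¬ IsOfFinAddOrder (I.proj 0 y) := by
  obtain ⟨q, -, e, -, hZL⟩ := Z.zetaLineIndex
  have hnt : ¬ IsOfFinAddOrder (layerZeroToTop W p κ (I.proj 0 y)) := not_isOfFinAddOrder_of_zetaLineOrthIndexAt W p hPT hZL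
  intro h
  obtain ⟨n, hn, hny⟩ := h.exists_nsmul_eq_zero
  exact hnt (isOfFinAddOrder_iff_nsmul_eq_zero.mpr ⟨n, hn, by rw [← map_nsmul (layerZeroToTop W p κ).hom, hny, map_zero]⟩)

/-- **`λ(0) ≠ 0` on a core package WITHOUT the clause `lam_constantCoeff_ne_zero`** (Lemma 13.10 (1)): from `j` injective with finite
cokernel, `j 𝐲 = λ • z` and the non-torsion of `proj₀ 𝐲` (`MemberHullNondegenerate.constantCoeff_ne_zero_of_hull_smul`).
[cite: Kato2004Asterisque, Lemma 13.10 (1) (p. 230) and §14.14 (14.14.1) (p. 243)] -/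
theorem _root_.Literature.NumberTheory.EllipticCurves.Kato2004.MemberHullZetaCoreInputs.lam_constantCoeff_ne_zero_of_zetaLineIndex
    (Z : MemberHullZetaCoreInputs W p κ γ I y) (hPT : poitouTate_selmerStructure_duality ℚ) :
    PowerSeries.constantCoeff Z.lam ≠ 0 :=
  constantCoeff_ne_zero_of_hull_smul I Z.j Z.j_injective Z.finite_coker Z.j_y (Z.not_isOfFinAddOrder_projZero hPT)

/-- **`z ≠ 0` on a core package WITHOUT the clause `z_ne_zero`** (Thm. 12.5 (1)): `z = 0` would force `j 𝐲 = 0`, `𝐲 = 0`, `proj₀ 𝐲 = 0`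
(`MemberHullNondegenerate.ne_zero_of_hull_smul`). [cite: Kato2004Asterisque, Thm. 12.5 (1) (p. 221)] -/
theorem _root_.Literature.NumberTheory.EllipticCurves.Kato2004.MemberHullZetaCoreInputs.z_ne_zero_of_zetaLineIndex
    (Z : MemberHullZetaCoreInputs W p κ γ I y) (hPT : poitouTate_selmerStructure_duality ℚ) : Z.z ≠ 0 :=
  ne_zero_of_hull_smul I Z.j Z.j_injective Z.j_y (Z.not_isOfFinAddOrder_projZero hPT)

/-- **`F ⧸ Λz` is torsion on a core package WITHOUT the clause `isTorsion_quotient`** (Thm. 12.5 (2); `κ` cyclotomic, `γ` a generator,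
`W(ℚ)` and `Ш(W)[p^∞]` finite): the hull has `Λ`-rank `≤ 1` by (R2)+(R0) (`MemberHullRankOne.isTorsion_hull_quotient`) and `z ≠ 0` by the
previous theorem. [cite: Kato2004Asterisque, Thm. 12.5 (2) (p. 222), 13.14 (p. 234), Thm. 14.5 (1) (p. 236)] -/
theorem _root_.Literature.NumberTheory.EllipticCurves.Kato2004.MemberHullZetaCoreInputs.isTorsion_quotient_of_zetaLineIndex
    (Z : MemberHullZetaCoreInputs W p κ γ I y) (hκ : κ.IsCyclotomic) (hγ : κ.IsTopGenerator γ)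
    (hPT : poitouTate_selmerStructure_duality ℚ) [Finite W.toAffine.Point] [Finite (AddCommGroup.primaryComponent W.sha p)] :
    Module.IsTorsion (IwasawaAlgebra p) (Z.F ⧸ (IwasawaAlgebra p) ∙ Z.z) :=
  haveI := Z.finite_F
  haveI := Z.torsionFree_F
  isTorsion_hull_quotient hκ hγ I Z.j Z.j_injective Z.finite_coker (Z.z_ne_zero_of_zetaLineIndex hPT)

end Summit.BirchSwinnertonDyer.BirchSwinnertonDyer.Theorems.CoreRedundantClauses

end
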